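import Summits.NavierStokesRegularity.NavierStokesRegularity.Theorems.EpisodeBaseT.Negative.RingPusherMirrorAnchorSign
import Summits.NavierStokesRegularity.FluidComputer.PalasekTowerTameCarrierAt
import HarnessLib

/-!
# The blob of record with the ring pusher BELOW it is NOT level-0 data: the strict anchor fails at the speed argmax
# (Negative lane, `EpisodeBaseT`, line «doormirror», stub D2a `SterileSmallCarrierT`)

Cell `ns-blowup`, seat `ns-blowup-refuter4` (g12; D-0074 GROUP C «BRIDGE SUPPORT», Negative lane (α)). Sequel of
`RingPusherMirrorAnchorSign` (p567521): instantiate its abstract `not_strictAnchor_add_smul_mirrorRingPusher` at the BLOB OF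
RECORD `tinyProfileAt R a = Y₀(R) • tinyBlob a` (`PalasekTowerTameCarrierAt`: even about `0`, flat at `0` — `Δ U_a (0) = 0`
(`tinyProfileAt_even_flat`) — supported in `B̄(0, 2a)`, `U_a 0 = Y₀ e₃` with `‖U_a 0‖ = Y₀` (`tinyProfileAt_zero`)).

* `not_strictAnchor_tinyProfileAt_add_smul_mirrorRingPusher` — for `0 < a ≤ 2`, every viscosity `ν`, the thinness `δ` of
  p564714/p567521 and EVERY amplitude `μ ≠ 0`: `¬ 0 < ⟪U 0, accel ν U 0⟫` for `U = U_a + μ • mirrorRingPusher δ`.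
* `not_levelZeroDataAt_tinyProfileAt_add_smul_mirrorRingPusher` — hence `U` is NOT `LevelZeroDataAt R U ρ` for ANY radius
  `ρ` and ANY rates `R` (the `anchor` field fails at `x = 0`, where `‖U 0‖ = Y₀` because the ring vanishes on `‖x‖ < 9/2`).

Both summands are sterile (axisymmetric, swirl-free: `isAxisymmetric_tinyProfileAt` / `hasNoSwirl_tinyProfileAt`, p559308;
`isAxisymmetric_mirrorRingPusher` / `hasNoSwirl_mirrorRingPusher`, p567521), smooth, divergence free and compactly supported —
so this is a sterile, admissible-looking small carrier that fails level 0 for a SIGN reason only: the mirror image of the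
configuration fc-prover-2's D2a carrier uses (ring ABOVE the blob, p564714 + `anchor_test_iff_fderiv3`). Reading for the
stub: D2a's `∃ U` must put the ring on the `+U(x₀)` side; «a thin sterile ring far from the blob» is not by itself a
level-0 device.

LABEL: kernel analysis (theorems only). WHAT THIS IS NOT: not Navier–Stokes evidence; not a refutation of D2a or of any
route item (D2a is existential — one good placement suffices); no flow, stage, schedule or certificate; sorry-free, std
axioms. bears_on: LADDER-NS N1 (route-NavierStokesRegularity-PalasekTowerBreakdown), item 20303, stub D2a.

References: A. J. Majda, A. L. Bertozzi (CUP 2002) §1.8 Prop. 1.16 [cite: MajdaBertozziCUP2002, §1.8 Prop. 1.16].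
-/

noncomputable section

open Literature.Analysis.FluidPDE
open Summit.NavierStokesRegularity.FluidComputer.PalasekTowerClayBridge
open Summit.NavierStokesRegularity.FluidComputer.PalasekTowerClayBridge.TinyBlob
open Summit.NavierStokesRegularity.FluidComputer.PalasekTowerClayBridge.Germ
open Summit.NavierStokesRegularity.EpisodeBaseTRingPusherMirrorAnchorSign
open MeasureTheory InnerProductSpace Metric
open scoped RealInnerProductSpace ContDiff Laplacian

-- nested operator types `ℝ³ →L[ℝ] ℝ³ →L[ℝ] ℝ`
set_option maxSynthPendingDepth 3

namespace Summit.NavierStokesRegularity.EpisodeBaseTSterileCarrierMirrorNotLevelZero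

/-- **The blob of record with the ring BELOW fails the strict anchor at the origin**, for every viscosity `ν`, the
thinness `δ` of `exists_mirrorRingPusher_anchor_integral_neg` and every amplitude `μ ≠ 0` (`0 < a ≤ 2`).
[cite: MajdaBertozziCUP2002, §1.8 Prop. 1.16] -/
theorem not_strictAnchor_tinyProfileAt_add_smul_mirrorRingPusher (R : TowerRates) {a : ℝ} (ha : 0 < a) (ha2 : a ≤ 2)
    (ν : ℝ) :
    ∃ δ : ℝ, 0 < δ ∧ δ ≤ 1 / 4 ∧ ∀ μ : ℝ, μ ≠ 0 →
      ¬ 0 < ⟪(tinyProfileAt R a + μ • mirrorRingPusher δ) 0, accel ν (tinyProfileAt R a + μ • mirrorRingPusher δ) 0⟫ := by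
  obtain ⟨heven, -, hflat⟩ := tinyProfileAt_even_flat R a
  have hsupp : tsupport (tinyProfileAt R a) ⊆ ball (0 : EuclideanSpace ℝ (Fin 3)) (9 / 2) := fun x hx => by
    have h := tsupport_tinyProfileAt_subset (R := R) ha hx
    rw [mem_closedBall, dist_zero_right] at h
    rw [mem_ball, dist_zero_right]
    linarith
  have hΔ : 0 ≤ -(ν * ⟪tinyProfileAt R a 0, (Δ (tinyProfileAt R a)) 0⟫) := by
    rw [hflat, inner_zero_right, mul_zero, neg_zero]
  exact not_strictAnchor_add_smul_mirrorRingPusher (contDiff_tinyProfileAt R a) (hasCompactSupport_tinyProfileAt ha)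
    (isDivFree_tinyProfileAt ha.ne') heven hsupp (R.Y_pos 0) (tinyProfileAt_zero R a).1 hΔ

/-- **The mirrored sterile carrier is NOT level-0 data**: for `0 < a ≤ 2`, the thinness `δ` above and every `μ ≠ 0`,
`¬ LevelZeroDataAt R (tinyProfileAt R a + μ • mirrorRingPusher δ) ρ` for EVERY radius `ρ` — the `anchor` field fails at
`x = 0`, a point of the speed ceiling (`‖U 0‖ = Y₀`: the ring vanishes on `‖x‖ < 9/2`). [cite: MajdaBertozziCUP2002, §1.8 Prop. 1.16] -/
theorem not_levelZeroDataAt_tinyProfileAt_add_smul_mirrorRingPusher (R : TowerRates) {a : ℝ} (ha : 0 < a) (ha2 : a ≤ 2) :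
    ∃ δ : ℝ, 0 < δ ∧ δ ≤ 1 / 4 ∧ ∀ μ : ℝ, μ ≠ 0 → ∀ ρ : ℝ,
      ¬ LevelZeroDataAt R (tinyProfileAt R a + μ • mirrorRingPusher δ) ρ := by
  obtain ⟨δ, hδ, hδ4, hnot⟩ := not_strictAnchor_tinyProfileAt_add_smul_mirrorRingPusher R ha ha2 1
  refine ⟨δ, hδ, hδ4, fun μ hμ ρ hL => hnot μ hμ (hL.anchor 0 ?_)⟩
  have h0 : mirrorRingPusher δ 0 = 0 :=
    mirrorRingPusher_eq_zero_of_norm_lt hδ hδ4 (by rw [norm_zero]; norm_num)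
  rw [Pi.add_apply, Pi.smul_apply, h0, smul_zero, add_zero]
  exact (tinyProfileAt_zero R a).2

end Summit.NavierStokesRegularity.EpisodeBaseTSterileCarrierMirrorNotLevelZero

end
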